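import Literature.NumberTheory.Weil1964.LocalWeilIndexQuadraticForm
import HarnessLib

/-!
# Scalars on the box lattices `(𝔭^a)^ι`: uniform box shifts for bounded families of homotheties

Layer `Literature/NumberTheory/Weil1964`, namespace `Literature.NumberTheory.Weil1964`; sequel of
`LocalGaussIntegralSeveralVariables` (the box lattices `primePowPiBox F ι m`, Weil's "réseaux" of `X = F^ι`,
[Weil1964, Chap. II n° 27, p. 174]) and `LocalWeilIndexQuadraticForm` (`exists_image_primePowPiBox_subset`: ONE linear
map shifts ONE box into some box).  THEOREMS ONLY, all proved:

* `smul_mem_primePowPiBox` — `s ∈ 𝔭^k`, `x ∈ (𝔭^n)^ι ⟹ s • x ∈ (𝔭^{k+n})^ι` (coordinatewise `𝔭^k · 𝔭^n ⊆ 𝔭^{k+n}`);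
* `smul_mem_primePowPiBox_sub` — the same in the "uniform shift" currency `x ∈ (𝔭^a)^ι ⟹ s • x ∈ (𝔭^{a−e})^ι` for
  `s ∈ 𝔭^{−e}`, for EVERY `a` with ONE `e`;
* `exists_forall_smul_mem_primePowPiBox_sub_of_subset` / `…_of_isCompact` — a family of scalars contained in one
  ball (e.g. a compact set of scalars) shifts every box by at most one common `e₀`;
* `exists_forall_smul_mem_primePowPiBox_sub_of_isCompact₃` — the three-family form (one common `e₀` for three bounded
  families), the shape of the «uniform box bounds» hypothesis (W3) of the finite-level trace of a big-cell family
  (`HeisenbergGroup.trace_restrict_fixed_eq_of_bigCell_family`, whose `γ_ k`, `B_ k⁻¹`, `δ_ k` are homotheties at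
  `ι = Fin 1`).

## References

* A. Weil, *Sur certains groupes d'opérateurs unitaires*, Acta Math. 111 (1964), Chap. II n° 27, p. 174
  (réseaux of `X`, "tout réseau est aussi grand qu'on veut"). [Weil1964]
-/

set_option autoImplicit false

noncomputable section

open Set
open scoped NNReal Pointwise
open Literature.NumberTheory.GaloisRepresentations.IsNonarchimedeanLocalField
open Literature.NumberTheory.Automorphic

namespace Literature.NumberTheory.Weil1964

variable {F : Type*} [Field F] [ValuativeRel F] [TopologicalSpace F] [IsNonarchimedeanLocalField F]
variable {ι : Type*}

/-- **a scalar in `𝔭^k` shifts the box `(𝔭^n)^ι` into `(𝔭^{k+n})^ι`** (coordinatewise `𝔭^k · 𝔭^n ⊆ 𝔭^{k+n}`).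
[cite: Weil1964, Chap. II n° 27, p. 174] -/
theorem smul_mem_primePowPiBox {s : F} {k n : ℤ} (hs : s ∈ primePowBall F k) {x : ι → F}
    (hx : x ∈ primePowPiBox F ι n) : s • x ∈ primePowPiBox F ι (k + n) :=
  mem_primePowPiBox_iff.2 fun i => by
    rw [Pi.smul_apply, smul_eq_mul]
    exact mul_mem_primePowBall hs (mem_primePowPiBox_iff.1 hx i)

/-- **uniform box shift by a scalar**: if `s ∈ 𝔭^{−e}` then `s • (𝔭^a)^ι ⊆ (𝔭^{a−e})^ι` for every `a`.
[cite: Weil1964, Chap. II n° 27, p. 174] -/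
theorem smul_mem_primePowPiBox_sub {s : F} {e : ℤ} (hs : s ∈ primePowBall F (-e)) (a : ℤ) {x : ι → F}
    (hx : x ∈ primePowPiBox F ι a) : s • x ∈ primePowPiBox F ι (a - e) := by
  have h := smul_mem_primePowPiBox hs hx
  rwa [show -e + a = a - e by ring] at h

/-- **a family of scalars inside one ball shifts all boxes by one common exponent**: if `S ⊆ 𝔭^k` then with
`e₀ := −k`, `s • (𝔭^a)^ι ⊆ (𝔭^{a−e₀})^ι` for all `s ∈ S` and all `a`. [cite: Weil1964, Chap. II n° 27, p. 174] -/
theorem exists_forall_smul_mem_primePowPiBox_sub_of_subset {S : Set F} {k : ℤ} (hS : S ⊆ primePowBall F k) :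
    ∃ e₀ : ℤ, ∀ s ∈ S, ∀ (a : ℤ) (x : ι → F), x ∈ primePowPiBox F ι a → s • x ∈ primePowPiBox F ι (a - e₀) :=
  ⟨-k, fun _ hs a _ hx => smul_mem_primePowPiBox_sub (by rw [neg_neg]; exact hS hs) a hx⟩

/-- **a compact set of scalars shifts all boxes by one common exponent** (a compact subset of `F` lies in one ball
`𝔭^k`, `exists_subset_primePowBall_of_isCompact`). [cite: Weil1964, Chap. II n° 27, p. 174] -/
theorem exists_forall_smul_mem_primePowPiBox_sub_of_isCompact {S : Set F} (hS : IsCompact S) :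
    ∃ e₀ : ℤ, ∀ s ∈ S, ∀ (a : ℤ) (x : ι → F), x ∈ primePowPiBox F ι a → s • x ∈ primePowPiBox F ι (a - e₀) := by
  obtain ⟨k, hk⟩ := exists_subset_primePowBall_of_isCompact hS
  exact exists_forall_smul_mem_primePowPiBox_sub_of_subset hk

/-- monotonicity of the uniform shift in the exponent: a shift by `e` is a shift by any `e' ≥ e`.
[cite: Weil1964, Chap. II n° 27, p. 174] -/
theorem smul_mem_primePowPiBox_sub_mono {e e' : ℤ} (h : e ≤ e') {s : F} {a : ℤ} {x : ι → F}
    (hx : s • x ∈ primePowPiBox F ι (a - e)) : s • x ∈ primePowPiBox F ι (a - e') :=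
  primePowPiBox_antitone (by omega) hx

/-- **three bounded families, one exponent**: if three sets of scalars lie in balls `𝔭^{k₁}`, `𝔭^{k₂}`, `𝔭^{k₃}`, one
common `e₀` shifts every box `(𝔭^a)^ι` into `(𝔭^{a−e₀})^ι` under all of them — the shape of the uniform box-bound
hypothesis of the finite-level trace of a big-cell family (three homothety families `γ`, `B⁻¹`, `δ`).
[cite: Weil1964, Chap. II n° 27, p. 174] -/
theorem exists_forall_smul_mem_primePowPiBox_sub_of_subset₃ {S₁ S₂ S₃ : Set F} {k₁ k₂ k₃ : ℤ}
    (h₁ : S₁ ⊆ primePowBall F k₁) (h₂ : S₂ ⊆ primePowBall F k₂) (h₃ : S₃ ⊆ primePowBall F k₃) :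
    ∃ e₀ : ℤ, ∀ (a : ℤ) (x : ι → F), x ∈ primePowPiBox F ι a →
      (∀ s ∈ S₁, s • x ∈ primePowPiBox F ι (a - e₀)) ∧ (∀ s ∈ S₂, s • x ∈ primePowPiBox F ι (a - e₀)) ∧
        (∀ s ∈ S₃, s • x ∈ primePowPiBox F ι (a - e₀)) := by
  refine ⟨max (-k₁) (max (-k₂) (-k₃)), fun a x hx => ⟨fun s hs => ?_, fun s hs => ?_, fun s hs => ?_⟩⟩
  · exact smul_mem_primePowPiBox_sub_mono (le_max_left _ _)
      (smul_mem_primePowPiBox_sub (e := -k₁) (by rw [neg_neg]; exact h₁ hs) a hx)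
  · exact smul_mem_primePowPiBox_sub_mono ((le_max_left _ _).trans (le_max_right _ _))
      (smul_mem_primePowPiBox_sub (e := -k₂) (by rw [neg_neg]; exact h₂ hs) a hx)
  · exact smul_mem_primePowPiBox_sub_mono ((le_max_right _ _).trans (le_max_right _ _))
      (smul_mem_primePowPiBox_sub (e := -k₃) (by rw [neg_neg]; exact h₃ hs) a hx)

end Literature.NumberTheory.Weil1964

end
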